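import Summits.ResolutionOfSingularities.ResolutionOfSingularities.Theorems.FrobeniusLadderFInjectiveMacaulayficationFHalfRowOfTwoStoreysLocal
import Summits.ResolutionOfSingularities.ResolutionOfSingularities.Theorems.FrobeniusLadderFInjectiveMacaulayficationGermOfBlowupTower
import HarnessLib

/-!
# (W-TD/W8) the GERM SHAPE of the local two-storey glue: a local second storey at a closed point `P` over `x` certifies `GermForm.FInjectivizationGermAt p x`
# (crux `FInjectiveMacaulayfication` stmt-ResolutionOfSingularities-15315, chain w45a; res-L1-w45a-plan-1 RULING R21.34 (d) «`f4pos_rowD_twoStorey : FInjectivizationGermAt 2 v`-shape row»;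
# seat res-L1-w45a-stub-1 g13; sibling of ✓ p664558 `fHalfConclusion_of_localSecondStorey` (same construction, Temkin 2.1.1 extension of the local centre, then ✓
# `GermOfBlowupTower.fInjectivizationGermAt_of_twoStep` instead of the per-floor glue))

[OURS · L1 W4.5a] Support file (`--supports stmt-ResolutionOfSingularities-15315 --as helper`); def-free; UNCONDITIONAL; no named fact; NOT a statement of any manuscript.
Nothing of the crux is proved. AI-written (AI review is weaker than expert review).

* ★★ `fInjectivizationGermAt_of_localSecondStorey` — `X` integral Noetherian, `x ∈ X`; STOREY 1 `π₁ : X₁ → X` a blowing up along `J₁ ≠ ⊥` with support meeting the generizations of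
  `x` only in `x`; a CLOSED point `P ∈ X₁` over `x`; a LOCAL STOREY 2 at `P`: `𝔍 ≠ ⊥` on `Spec 𝒪_{X₁,P}` supported at the closed point with EVERY blowing up FULL at every stalk;
  `X₁` FULL at every other point over a generization of `x`. THEN `FInjectivizationGermAt p x`: some `𝓚 ≠ ⊥` on `Spec 𝒪_{X,x}`, supported at the closed point, ALL of whose
  blowings up are FULL at every stalk (extend `𝔍` to `J′` on `X₁` with `Supp J′ = {P}` — Temkin 2.1.1, `ProOpenIdealExtension` —, blow up, compose the two floors — ✓ `GermOfBlowupTower`).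
* `fInjectivizationGermAt_of_localSecondStorey_affine` — AFFINE first storey `π₁ = affineBlowup.π (τ * K)` over `Spec A₀`, `v ⊆ √τ`, `v ⊆ √K`.
[cite: Temkin2008, Lemma 2.1.1 and Lemma 2.1.4] [cite: StacksProject, Tag 080B and Tag 01J7] [cite: GortzWedhorn2020, Prop. 13.91]
-/

-- single-problem summit: the doubled namespace component is forced
set_option linter.dupNamespace false

noncomputable section

namespace Summit.ResolutionOfSingularities.ResolutionOfSingularities.Theorems.FInjectiveMacaulayfication.FHalfRowOfTwoStoreys

open CategoryTheory CategoryTheory.Limits AlgebraicGeometry TopologicalSpace IsLocalRing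
open Literature.AlgebraicGeometry.Resolution
open Summit.ResolutionOfSingularities.ResolutionOfSingularities.Theorems.FInjectiveMacaulayfication
open SliceableCentre GermOfGlobalBlowup GermForm

/-- ★★ **GERM SHAPE OF THE LOCAL TWO-STOREY GLUE.** See the module docstring. [cite: Temkin2008, Lemma 2.1.1 and Lemma 2.1.4] [cite: StacksProject, Tag 080B] -/
theorem fInjectivizationGermAt_of_localSecondStorey (p : ℕ) {X X₁ : Scheme.{0}} [IsIntegral X] [IsNoetherian X] (x : X)
    {π₁ : X₁ ⟶ X} {J₁ : X.IdealSheafData} (hπ₁ : IsBlowup π₁ J₁) (hJ₁ : J₁ ≠ ⊥)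
    (hsupp₁ : ∀ y ∈ (J₁.support : Set X), y ⤳ x → y = x)
    (P : X₁) (hPx : π₁.base P = x) (hP : IsClosed ({P} : Set X₁))
    (𝔍 : (Spec (X₁.presheaf.stalk P)).IdealSheafData) (h𝔍 : 𝔍 ≠ ⊥)
    (h𝔍supp : ∀ s ∈ (𝔍.support : Set (Spec (X₁.presheaf.stalk P))), s = closedPoint (X₁.presheaf.stalk P))
    (hfull₂ : ∀ (S'' : Scheme.{0}) (g : S'' ⟶ Spec (X₁.presheaf.stalk P)), IsBlowup g 𝔍 → ∀ s : S'', FullCl p (S''.presheaf.stalk s))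
    (hfull₁ : ∀ x₁ : X₁, x₁ ≠ P → π₁.base x₁ ⤳ x → FullCl p (X₁.presheaf.stalk x₁)) :
    FInjectivizationGermAt p x := by
  haveI : IsProper π₁ := hπ₁.isProper
  haveI : IsLocallyNoetherian X₁ := LocallyOfFiniteType.isLocallyNoetherian π₁
  -- Temkin 2.1.1 for `S := X₁ ×_{X₁} Spec 𝒪_{X₁,P} ≅ Spec 𝒪_{X₁,P}`
  set m := X₁.fromSpecStalk P with hm
  set e := pullback.snd (𝟙 X₁) m with he
  have hje : pullback.fst (𝟙 X₁) m = e ≫ m := by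
    have := pullback.condition (f := 𝟙 X₁) (g := m)
    rw [Category.comp_id] at this
    exact this
  obtain ⟨J', hJ'comap, hJ'supp⟩ := exists_idealSheaf_extension_fromSpecStalk (𝟙 X₁) P (𝔍.comap e)
  have hJ'm : J'.comap m = 𝔍 := by
    apply comap_injective_of_isIso e
    rw [← Scheme.IdealSheafData.comap_comp, ← hje, hJ'comap]
  have hJ'ne : J' ≠ ⊥ := by
    intro h0
    apply h𝔍
    rw [← hJ'm, h0, Scheme.IdealSheafData.comap_bot]
  have hJ'P : ∀ y₁ ∈ (J'.support : Set X₁), y₁ = P := by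
    intro y₁ hy₁
    rw [hJ'supp] at hy₁
    have hsub : pullback.fst (𝟙 X₁) m '' ((𝔍.comap e).support : Set _) ⊆ {P} := by
      rintro _ ⟨t, ht, rfl⟩
      rw [Scheme.IdealSheafData.support_comap] at ht
      have ht' : e t ∈ (𝔍.support : Set _) := ht
      have h1 : e t = closedPoint (X₁.presheaf.stalk P) := h𝔍supp _ ht'
      show (pullback.fst (𝟙 X₁) m) t ∈ ({P} : Set X₁)
      rw [hje, Scheme.Hom.comp_apply, h1, hm, Scheme.fromSpecStalk_closedPoint]
      exact Set.mem_singleton P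
    exact Set.mem_singleton_iff.mp ((closure_minimal hsub hP) hy₁)
  -- STOREY 2 globally, and its FULL-ness over the generizations of `x`
  obtain ⟨X₂, π₂, hπ₂⟩ := exists_isBlowup X₁ J'
  have hsupp' : ∀ y₁ ∈ (J'.support : Set X₁), π₁.base y₁ ⤳ x → π₁.base y₁ = x := fun y₁ hy₁ _ => by rw [hJ'P y₁ hy₁, hPx]
  have hfull : ∀ x₂ : X₂, (π₂ ≫ π₁).base x₂ ⤳ x → FullCl p (X₂.presheaf.stalk x₂) := by
    intro x₂ hx₂
    by_cases hgen : x₂ ∈ Set.range (pullback.fst π₂ m)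
    · obtain ⟨t, rfl⟩ := hgen
      haveI : Flat m := flat_fromSpecStalk X₁ P
      have hB : IsBlowup (pullback.snd π₂ m) (J'.comap m) := hπ₂.pullback_snd_of_flat m
      rw [hJ'm] at hB
      haveI := isIso_stalkMap_pullback_fst_fromSpecStalk π₂ P t
      exact FTemkinClosedPoints.fullCl_of_isIso_stalkMap p (pullback.fst π₂ m) t (hfull₂ _ _ hB t)
    · have hnot : ¬ π₂.base x₂ ⤳ P := by
        intro hsp
        apply hgen
        rw [range_pullback_fst_fromSpecStalk]
        exact hsp
      have hne : π₂.base x₂ ≠ P := fun h => hnot (h ▸ specializes_rfl)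
      have hU : π₂.base x₂ ∈ (⟨(J'.support : Set X₁)ᶜ, J'.support.isClosed.isOpen_compl⟩ : X₁.Opens) := fun h => hne (hJ'P _ h)
      haveI : IsIso (π₂ ∣_ (⟨(J'.support : Set X₁)ᶜ, J'.support.isClosed.isOpen_compl⟩ : X₁.Opens)) := hπ₂.isIso_compl
      haveI := isIso_stalkMap_of_isIso_morphismRestrict π₂ _ x₂ hU
      refine FTemkinClosedPoints.fullCl_of_isIso_stalkMap' p π₂ x₂ (hfull₁ _ hne ?_)
      have : (π₂ ≫ π₁).base x₂ = π₁.base (π₂.base x₂) := by rw [Scheme.Hom.comp_base]; rfl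
      rw [this] at hx₂
      exact hx₂
  exact GermOfBlowupTower.fInjectivizationGermAt_of_twoStep p x hπ₁ hJ₁ hsupp₁ hπ₂ hJ'ne hsupp' hfull

/-- **AFFINE FIRST-STOREY FORM** of the germ shape: `π₁ = affineBlowup.π (τ * K)` over `Spec A₀` (`A₀` a Noetherian domain, `τ, K ≠ ⊥`, `v ⊆ √τ`, `v ⊆ √K`).
[cite: Temkin2008, Lemma 2.1.4] [cite: GortzWedhorn2020, (13.19)] -/
theorem fInjectivizationGermAt_of_localSecondStorey_affine (p : ℕ) {A₀ : Type} [CommRing A₀] [IsDomain A₀] [IsNoetherianRing A₀] (τ K : Ideal A₀)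
    (hτ : τ ≠ ⊥) (hK : K ≠ ⊥) (v : Spec (.of A₀)) (hvτ : v.asIdeal ≤ τ.radical) (hvK : v.asIdeal ≤ K.radical)
    (P : ↥(affineBlowup (τ * K))) (hPx : (affineBlowup.π (τ * K)).base P = v) (hP : IsClosed ({P} : Set ↥(affineBlowup (τ * K))))
    (𝔍 : (Spec ((affineBlowup (τ * K)).presheaf.stalk P)).IdealSheafData) (h𝔍 : 𝔍 ≠ ⊥)
    (h𝔍supp : ∀ s ∈ (𝔍.support : Set (Spec ((affineBlowup (τ * K)).presheaf.stalk P))), s = closedPoint ((affineBlowup (τ * K)).presheaf.stalk P))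
    (hfull₂ : ∀ (S'' : Scheme.{0}) (g : S'' ⟶ Spec ((affineBlowup (τ * K)).presheaf.stalk P)), IsBlowup g 𝔍 → ∀ s : S'', FullCl p (S''.presheaf.stalk s))
    (hfull₁ : ∀ x₁ : ↥(affineBlowup (τ * K)), x₁ ≠ P → (affineBlowup.π (τ * K)).base x₁ ⤳ v → FullCl p ((affineBlowup (τ * K)).presheaf.stalk x₁)) :
    FInjectivizationGermAt p v := by
  have hπ : IsBlowup (affineBlowup.π (τ * K)) (affineBlowup.idealSheaf (τ * K)) := affineBlowup.isBlowup (τ * K)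
  have hJ : affineBlowup.idealSheaf (τ * K) ≠ ⊥ := affineBlowup.idealSheaf_ne_bot (mul_ne_zero hτ hK)
  have hsupp : ∀ y ∈ ((affineBlowup.idealSheaf (τ * K)).support : Set (Spec (.of A₀))), y ⤳ v → y = v := by
    intro y hy hyv
    rw [affineBlowup.support_idealSheaf] at hy
    have hLy : τ * K ≤ y.asIdeal := fun a ha => hy ha
    have hτy : τ ≤ y.asIdeal ∨ K ≤ y.asIdeal := y.2.mul_le.mp hLy
    have h1 : v.asIdeal ≤ y.asIdeal := by
      rcases hτy with h | h
      · exact hvτ.trans (y.2.radical_le_iff.mpr h)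
      · exact hvK.trans (y.2.radical_le_iff.mpr h)
    have h2 : y.asIdeal ≤ v.asIdeal := (PrimeSpectrum.le_iff_specializes y v).mpr hyv
    exact PrimeSpectrum.ext (le_antisymm h2 h1)
  exact fInjectivizationGermAt_of_localSecondStorey p v hπ hJ hsupp P hPx hP 𝔍 h𝔍 h𝔍supp hfull₂ hfull₁

end Summit.ResolutionOfSingularities.ResolutionOfSingularities.Theorems.FInjectiveMacaulayfication.FHalfRowOfTwoStoreys

end
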